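import Mathlib
import Summits.RiemannHypothesis.RiemannHypothesis.Theorems.WeilDetectionPhase
import HarnessLib

/-!
# Format C, design C∞: admissibility of the window-polynomial profile families

Route context: Fourier–Galerkin / Schur-complement certificates of Weil positivity on a window ("format C";
cell memo `run/shared/lean/pub/rh-explicit/rh-explicit-weil-10/KERNEL-LEVER.md` §11, §19; supporting
stmt-RiemannHypothesis-0098; seat rh-explicit-weil-10).

The C∞ front door (`weilPositivityOn_of_formatC_cinf`) asks of each profile `f : ℝ → ℂ`: `ContDiff ℝ 3 f`, parity,
real-valuedness, and the `C¹`-periodising boundary data (`f′(−a) = f′(a)`; odd profiles also `f(a) = 0`).  For the profile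
CLASS of KERNEL-LEVER §11 — even `(a² − x²)²·h(x)`, odd `(a² − x²)·x·h(x)` with `h` even — these are structural:

* (reused) `WeilConverseWindow.deriv_neg_of_odd` — an odd function has an even derivative;
* `evenProfile_contDiff`, `evenProfile_even`, `evenProfile_conj`, `evenProfile_deriv_boundary` — for
  `f(x) = ↑((a² − x²)² h(x))`, `h ∈ C³`: `C³`, even if `h` is, real, and `f′(a) = 0 = f′(−a)`;
* `oddProfile_contDiff`, `oddProfile_odd`, `oddProfile_conj`, `oddProfile_apply_self`, `oddProfile_deriv_boundary` — for
  `f(x) = ↑((a² − x²)·x·h(x))`, `h ∈ C³` even: `C³`, odd, real, `f(a) = 0`, `f′(−a) = f′(a)`;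
* `contDiff_evenPolynomial`, `evenPolynomial_even` — `h(x) = Σ_{q<d} c_q x^{2q}` qualifies.

Elementary calculus; standard axioms; no definitions; no RH claim.
-/

-- `Summit.RiemannHypothesis.RiemannHypothesis.…` is the layout-mandated namespace (summit = problem name).
set_option linter.dupNamespace false

noncomputable section

open scoped ComplexConjugate

namespace Summit.RiemannHypothesis.RiemannHypothesis.Theorems.WeilFormatC

/-! ## Odd functions have even derivatives

The derivative of an odd function is even — already in the tree as `WeilConverseWindow.deriv_neg_of_odd`
(`WeilDetectionPhase.lean`); it is reused below. -/

/-! ## The even family `(a² − x²)² h(x)` -/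

section Even

variable (a : ℝ) {h : ℝ → ℝ}

/-- `C³` of the even profile. -/
theorem evenProfile_contDiff (hh : ContDiff ℝ 3 h) :
    ContDiff ℝ 3 (fun x : ℝ ↦ ((((a ^ 2 - x ^ 2) ^ 2 * h x : ℝ)) : ℂ)) := by
  have hg : ContDiff ℝ 3 (fun x : ℝ ↦ (a ^ 2 - x ^ 2) ^ 2 * h x) :=
    ((contDiff_const.sub (contDiff_id.pow 2)).pow 2).mul hh
  exact Complex.ofRealCLM.contDiff.comp hg

/-- Evenness of the even profile (for `h` even). -/
theorem evenProfile_even (hhe : ∀ x, h (-x) = h x) (x : ℝ) :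
    (fun x : ℝ ↦ ((((a ^ 2 - x ^ 2) ^ 2 * h x : ℝ)) : ℂ)) (-x) = (fun x : ℝ ↦ ((((a ^ 2 - x ^ 2) ^ 2 * h x : ℝ)) : ℂ)) x := by
  simp only [neg_sq, hhe]

/-- The even profile is real-valued. -/
theorem evenProfile_conj (x : ℝ) :
    conj ((fun x : ℝ ↦ ((((a ^ 2 - x ^ 2) ^ 2 * h x : ℝ)) : ℂ)) x) = (fun x : ℝ ↦ ((((a ^ 2 - x ^ 2) ^ 2 * h x : ℝ)) : ℂ)) x :=
  Complex.conj_ofReal _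

/-- The derivative of the even profile at `x`: `↑(2(a² − x²)(−2x)h(x) + (a² − x²)²h′(x))`. -/
theorem evenProfile_hasDerivAt (hh : ContDiff ℝ 3 h) (x : ℝ) :
    HasDerivAt (fun x : ℝ ↦ ((((a ^ 2 - x ^ 2) ^ 2 * h x : ℝ)) : ℂ))
      (((2 : ℕ) * (a ^ 2 - x ^ 2) ^ (2 - 1) * (-((2 : ℕ) * x ^ (2 - 1))) * h x + (a ^ 2 - x ^ 2) ^ 2 * deriv h x : ℝ) : ℂ) x := by
  have hd : Differentiable ℝ h := hh.differentiable (by norm_num)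
  have hw : HasDerivAt (fun x : ℝ ↦ a ^ 2 - x ^ 2) (-((2 : ℕ) * x ^ (2 - 1))) x :=
    (hasDerivAt_pow 2 x).const_sub (a ^ 2)
  have hg : HasDerivAt (fun x : ℝ ↦ (a ^ 2 - x ^ 2) ^ 2 * h x)
      ((2 : ℕ) * (a ^ 2 - x ^ 2) ^ (2 - 1) * (-((2 : ℕ) * x ^ (2 - 1))) * h x + (a ^ 2 - x ^ 2) ^ 2 * deriv h x) x :=
    (hw.pow 2).mul (hd x).hasDerivAt
  exact hg.ofReal_comp

/-- **Boundary data of the even profile**: `f′(a) = 0` and `f′(−a) = 0`, hence `f′(−a) = f′(a)`. -/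
theorem evenProfile_deriv_boundary (hh : ContDiff ℝ 3 h) :
    deriv (fun x : ℝ ↦ ((((a ^ 2 - x ^ 2) ^ 2 * h x : ℝ)) : ℂ)) (-a)
      = deriv (fun x : ℝ ↦ ((((a ^ 2 - x ^ 2) ^ 2 * h x : ℝ)) : ℂ)) a := by
  rw [(evenProfile_hasDerivAt a hh (-a)).deriv, (evenProfile_hasDerivAt a hh a).deriv]
  simp

end Even

/-! ## The odd family `(a² − x²)·x·h(x)` -/

section Odd

variable (a : ℝ) {h : ℝ → ℝ}

/-- `C³` of the odd profile. -/
theorem oddProfile_contDiff (hh : ContDiff ℝ 3 h) :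
    ContDiff ℝ 3 (fun x : ℝ ↦ ((((a ^ 2 - x ^ 2) * x * h x : ℝ)) : ℂ)) := by
  have hg : ContDiff ℝ 3 (fun x : ℝ ↦ (a ^ 2 - x ^ 2) * x * h x) :=
    ((contDiff_const.sub (contDiff_id.pow 2)).mul contDiff_id).mul hh
  exact Complex.ofRealCLM.contDiff.comp hg

/-- Oddness of the odd profile (for `h` even). -/
theorem oddProfile_odd (hhe : ∀ x, h (-x) = h x) (x : ℝ) :
    (fun x : ℝ ↦ ((((a ^ 2 - x ^ 2) * x * h x : ℝ)) : ℂ)) (-x)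
      = -(fun x : ℝ ↦ ((((a ^ 2 - x ^ 2) * x * h x : ℝ)) : ℂ)) x := by
  simp only [neg_sq, hhe]
  push_cast
  ring

/-- The odd profile is real-valued. -/
theorem oddProfile_conj (x : ℝ) :
    conj ((fun x : ℝ ↦ ((((a ^ 2 - x ^ 2) * x * h x : ℝ)) : ℂ)) x) = (fun x : ℝ ↦ ((((a ^ 2 - x ^ 2) * x * h x : ℝ)) : ℂ)) x :=
  Complex.conj_ofReal _

/-- The odd profile vanishes at the right end point. -/
theorem oddProfile_apply_self :
    (fun x : ℝ ↦ ((((a ^ 2 - x ^ 2) * x * h x : ℝ)) : ℂ)) a = 0 := by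
  simp

/-- **Boundary data of the odd profile**: `f′(−a) = f′(a)` (odd ⟹ even derivative). -/
theorem oddProfile_deriv_boundary (hhe : ∀ x, h (-x) = h x) :
    deriv (fun x : ℝ ↦ ((((a ^ 2 - x ^ 2) * x * h x : ℝ)) : ℂ)) (-a)
      = deriv (fun x : ℝ ↦ ((((a ^ 2 - x ^ 2) * x * h x : ℝ)) : ℂ)) a :=
  WeilConverseWindow.deriv_neg_of_odd (oddProfile_odd a hhe) a

end Odd

/-! ## Even polynomials qualify -/

/-- `h(x) = Σ_{q<d} c_q x^{2q}` is smooth. -/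
theorem contDiff_evenPolynomial (c : ℕ → ℝ) (d : ℕ) (n : WithTop ℕ∞) :
    ContDiff ℝ n (fun x : ℝ ↦ ∑ q ∈ Finset.range d, c q * x ^ (2 * q)) :=
  ContDiff.sum fun _ _ ↦ contDiff_const.mul (contDiff_id.pow _)

/-- `h(x) = Σ_{q<d} c_q x^{2q}` is even. -/
theorem evenPolynomial_even (c : ℕ → ℝ) (d : ℕ) (x : ℝ) :
    (∑ q ∈ Finset.range d, c q * (-x) ^ (2 * q)) = ∑ q ∈ Finset.range d, c q * x ^ (2 * q) := by
  refine Finset.sum_congr rfl fun q _ ↦ ?_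
  rw [pow_mul, pow_mul, neg_sq]

end Summit.RiemannHypothesis.RiemannHypothesis.Theorems.WeilFormatC

end
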